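import Summits.QuantumAdvantage.QuantumAdvantage.Theses.RandomOracleGauge

/-!
# Route `RandomOracleGauge`: the glue item `AAConjAssembly` (stmt-QuantumAdvantage-17875) — PROVED

Strategist decomposition (unit cstrat-stmt-QuantumAdvantage-10748-r1, BC2 redirect) of the route's
conjecture-grade crux `AAConj` (stmt-QuantumAdvantage-10748) — the Aaronson–Ambainis conjecture "bounded
low-degree polynomials have an influential variable" (arXiv:0911.0996 Conj. 6 = ToC 10 (2014) Conj. 1.7),
verbatim `Literature.Computability.QuantumComplexity.AAConjecture` — into THREE load-bearing pieces, filed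
(rev 6 of the route; `route edit --split` is refused outside a final cycle, so they are top-level cruxes) as

* `DecoupledCoreAA` (stmt-QuantumAdvantage-17872, open core): the conjecture RESTRICTED TWICE — to
  ONE-BLOCK-DECOUPLED polynomials `q` on `N + N` variables (as a cube function
  `q(y,z) = c₀ + Σ_i (±1)^{y_i} g_i(z)`, O'Donnell–Zhao's `f̃` up to an additive constant) and to the
  POLYNOMIALLY-SMALL-VARIANCE regime `Var q ≥ 1/(K₀ d^κ₀)`, the bound `C/d^c` depending on the regime;
* `OneBlockDecoupling` (stmt-QuantumAdvantage-17873, theorem in print): O'Donnell–Zhao, *Polynomial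
  bounds for decoupling, with applications*, CCC 2016 = arXiv:1512.01603, Cor. 2.12 (`‖f̃‖_∞ ≤ O(k²)‖f‖_∞`)
  with the bookkeeping of their Thm. 2.13 ("the AA Conjecture holds iff it holds for one-block decoupled
  functions"): every `[0,1]`-bounded `p` of degree `≤ d` has a `[0,1]`-bounded one-block-decoupled
  companion `q` of degree `≤ d` with `Var p ≤ K d^κ Var q` and every influence of `q` at most `K d^κ`
  times an influence of `p`;
* `VarianceAmplification` (stmt-QuantumAdvantage-17874, new elementary reduction): from `Var p ≥ ε` build
  a `[0,1]`-bounded `q` of degree `≤ K d/ε^κ` with `Var q ≥ v` (ABSOLUTE) and every influence of `q` at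
  most `(K/ε^κ)` times an influence of `p`;

and the glue support item `AAConjAssembly := DecoupledCoreAA → OneBlockDecoupling → VarianceAmplification
→ AAConj` (stmt-QuantumAdvantage-17875), which THIS FILE PROVES (`AAConjAssembly_proof`, sorry-free, axioms
propext / Classical.choice / Quot.sound). The proof is real arithmetic only: amplify (`q₁`, degree
`≤ D ≤ K₁ d/ε^κ₁`, `Var q₁ ≥ v`), decouple (`q₂`, degree `≤ D`, `v ≤ Var q₁ ≤ K₂ D^κ₂ Var q₂`), apply the core
in the regime `(κ₂, K₂/v)`, pull the influence `≥ C/D^c` of a variable of `q₂` back through the two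
comparison clauses: `Inf_i p ≥ C ε^κ₁/(K₁ K₂ D^{c+κ₂}) ≥ (C/(K₂ K₁^{1+c+κ₂}))·(ε/d)^{κ₁(1+c+κ₂)+c+κ₂}`
(using `Var p ≤ 1`, hence `ε ≤ 1`, and `d ≥ 1`).

TO LAND (prover; planners cannot write `Theorems/`, D-0016): copy this file verbatim to
`Summits/QuantumAdvantage/QuantumAdvantage/Theorems/RandomOracleGaugeAAConjAssembly.lean` and
`ledger propose --kind proof --workitem stmt-QuantumAdvantage-17875`.

References: O'Donnell–Zhao arXiv:1512.01603 (Def. 1.1, Cor. 2.12, Thm. 2.13 and its proof p. 7, §4 Lemma 4.1);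
Aaronson–Ambainis arXiv:0911.0996 (Conj. 6); Escudero Gutiérrez arXiv:2304.06713 §1 (survey of the known
reductions of AA: one-block decoupling [OZ15], Lovett–Zhang fractional certificates [LZ22]).
-/

set_option linter.dupNamespace false -- D-0017: single-problem summit ⇒ `QuantumAdvantage.QuantumAdvantage` by design

open Literature.Computability.QuantumComplexity
open Summit.QuantumAdvantage.QuantumAdvantage.Theses.RandomOracleGauge

namespace Summit.QuantumAdvantage.QuantumAdvantage.Theorems.RandomOracleGauge

/-! ### Bookkeeping: the variance of a `[0,1]`-bounded polynomial is at most `1` -/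

/-- `E[f] ≤ 1` if `f ≤ 1` pointwise. [folklore] -/
theorem boolAvg_le_one' {N : ℕ} {f : (Fin N → Bool) → ℝ} (hf : ∀ x, f x ≤ 1) : boolAvg f ≤ 1 := by
  unfold boolAvg
  rw [div_le_one (by positivity)]
  calc ∑ x, f x ≤ ∑ _x : Fin N → Bool, (1 : ℝ) := Finset.sum_le_sum fun x _ => hf x
    _ = 2 ^ N := by simp

/-- `Var[p] ≤ 1` for a polynomial with `0 ≤ p ≤ 1` on the cube. [folklore] -/
theorem boolVariance_le_one' {N : ℕ} {p : MvPolynomial (Fin N) ℝ}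
    (hb : ∀ x, 0 ≤ evalBool p x ∧ evalBool p x ≤ 1) : boolVariance p ≤ 1 := by
  have hμ0 : 0 ≤ boolAvg (evalBool p) := boolAvg_nonneg fun x => (hb x).1
  have hμ1 : boolAvg (evalBool p) ≤ 1 := boolAvg_le_one' fun x => (hb x).2
  unfold boolVariance
  refine boolAvg_le_one' fun x => ?_
  have h0 := (hb x).1
  have h1 := (hb x).2
  nlinarith

/-! ### The assembly `DecoupledCoreAA → OneBlockDecoupling → VarianceAmplification → AAConj` -/

/-- **Assembly of the split of `AAConj`**: the decoupled small-variance core (`DecoupledCoreAA`),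
O'Donnell–Zhao one-block decoupling (`OneBlockDecoupling`, arXiv:1512.01603 Cor. 2.12/Thm. 2.13) and
variance amplification (`VarianceAmplification`) together imply the Aaronson–Ambainis conjecture as filed
(`AAConj`). [cite: ODonnellZhao2016, Cor. 2.12 and Thm. 2.13] [cite: AaronsonAmbainis2014, Conj. 6] -/
theorem AAConj_of_subs (hCore : DecoupledCoreAA) (hOZ : OneBlockDecoupling)
    (hAmp : VarianceAmplification) : AAConj := by
  obtain ⟨v, K₁, κ₁, hv, hK₁, hA⟩ := hAmp
  obtain ⟨κ₂, K₂, hK₂, hO⟩ := hOZ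
  obtain ⟨c, C, hC, hX⟩ := hCore κ₂ (K₂ / v) (div_pos hK₂ hv)
  -- the constants of AAConj
  obtain ⟨e, he⟩ : ∃ e : ℕ, e = c + κ₂ := ⟨_, rfl⟩
  refine ⟨κ₁ * (1 + e) + e, C / (K₂ * K₁ ^ (1 + e)), by positivity, ?_⟩
  intro N d p ε hd hp hb hε hεv
  have hε1 : ε ≤ 1 := hεv.trans (boolVariance_le_one' hb)
  have hd1 : (1 : ℝ) ≤ d := by exact_mod_cast hd
  have hd0 : (0 : ℝ) < d := by linarith
  -- amplify
  obtain ⟨N₁, D, q₁, hD1, hDle, hq₁deg, hq₁b, hq₁v, hq₁inf⟩ := hA N d p ε hd hp hb hε hεv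
  have hD1' : (1 : ℝ) ≤ D := by exact_mod_cast hD1
  have hD0 : (0 : ℝ) < D := by linarith
  -- decouple
  obtain ⟨q₂, hq₂dec, hq₂deg, hq₂b, hq₂var, hq₂inf⟩ := hO N₁ D q₁ hD1 hq₁deg hq₁b
  -- the core applies in the regime (κ₂, K₂ / v)
  have hreg : 1 ≤ K₂ / v * (D : ℝ) ^ κ₂ * boolVariance q₂ := by
    have h1 : v ≤ K₂ * (D : ℝ) ^ κ₂ * boolVariance q₂ := hq₁v.trans hq₂var
    have h2 : K₂ / v * (D : ℝ) ^ κ₂ * boolVariance q₂ = (K₂ * (D : ℝ) ^ κ₂ * boolVariance q₂) / v := by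
      ring
    rw [h2, le_div_iff₀ hv, one_mul]
    exact h1
  obtain ⟨j₂, hj₂⟩ := hX N₁ D q₂ hq₂dec hD1 hq₂deg hq₂b hreg
  obtain ⟨j₁, hj₁⟩ := hq₂inf j₂
  obtain ⟨i, hi⟩ := hq₁inf j₁
  refine ⟨i, ?_⟩
  set I : ℝ := influence i p with hI
  have hI0 : 0 ≤ I := influence_nonneg i p
  -- the chain `C / D^c ≤ K₂ D^κ₂ · (K₁/ε^κ₁) · I`
  have hchain : C / (D : ℝ) ^ c ≤ K₂ * (D : ℝ) ^ κ₂ * (K₁ / ε ^ κ₁ * I) :=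
    hj₂.trans (hj₁.trans (mul_le_mul_of_nonneg_left hi (by positivity)))
  -- hence `I ≥ C ε^κ₁ / (K₁ K₂ D^(c+κ₂))`
  have hεκ : 0 < ε ^ κ₁ := by positivity
  have hstep1 : C * ε ^ κ₁ / (K₁ * K₂ * (D : ℝ) ^ e) ≤ I := by
    rw [div_le_iff₀ (by positivity)]
    have h3 : C ≤ K₂ * (D : ℝ) ^ κ₂ * (K₁ / ε ^ κ₁ * I) * (D : ℝ) ^ c := by
      have := hchain
      rwa [div_le_iff₀ (by positivity)] at this
    have h4 : K₂ * (D : ℝ) ^ κ₂ * (K₁ / ε ^ κ₁ * I) * (D : ℝ) ^ c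
        = (I * (K₁ * K₂ * (D : ℝ) ^ e)) / ε ^ κ₁ := by
      rw [he, pow_add]; field_simp
    rw [h4, le_div_iff₀ hεκ] at h3
    linarith
  -- and `D ≤ K₁ d / ε^κ₁` turns `D^e` into `(K₁ d/ε^κ₁)^e`
  have hDpow : (D : ℝ) ^ e ≤ (K₁ * d / ε ^ κ₁) ^ e := pow_le_pow_left₀ hD0.le hDle e
  have hstep2 : C * ε ^ κ₁ / (K₁ * K₂ * (K₁ * d / ε ^ κ₁) ^ e) ≤ C * ε ^ κ₁ / (K₁ * K₂ * (D : ℝ) ^ e) := by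
    apply div_le_div_of_nonneg_left (by positivity) (by positivity)
    exact mul_le_mul_of_nonneg_left hDpow (by positivity)
  -- rewrite the left-hand side as `C'·ε^{κ₁(1+e)}/d^e`
  have hrew : C * ε ^ κ₁ / (K₁ * K₂ * (K₁ * d / ε ^ κ₁) ^ e)
      = C / (K₂ * K₁ ^ (1 + e)) * (ε ^ (κ₁ * (1 + e)) / (d : ℝ) ^ e) := by
    rw [div_pow, mul_pow, ← pow_mul]
    field_simp
    ring
  -- compare with the AAConj-shaped bound
  have hfinal : C / (K₂ * K₁ ^ (1 + e)) * (ε / d) ^ (κ₁ * (1 + e) + e)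
      ≤ C / (K₂ * K₁ ^ (1 + e)) * (ε ^ (κ₁ * (1 + e)) / (d : ℝ) ^ e) := by
    apply mul_le_mul_of_nonneg_left _ (by positivity)
    rw [div_pow]
    have hnum : ε ^ (κ₁ * (1 + e) + e) ≤ ε ^ (κ₁ * (1 + e)) :=
      pow_le_pow_of_le_one hε.le hε1 (Nat.le_add_right _ _)
    have hden : (d : ℝ) ^ e ≤ (d : ℝ) ^ (κ₁ * (1 + e) + e) :=
      pow_le_pow_right₀ hd1 (Nat.le_add_left _ _)
    exact div_le_div₀ (by positivity) hnum (by positivity) hden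
  calc C / (K₂ * K₁ ^ (1 + e)) * (ε / d) ^ (κ₁ * (1 + e) + e)
      ≤ C / (K₂ * K₁ ^ (1 + e)) * (ε ^ (κ₁ * (1 + e)) / (d : ℝ) ^ e) := hfinal
    _ = C * ε ^ κ₁ / (K₁ * K₂ * (K₁ * d / ε ^ κ₁) ^ e) := hrew.symm
    _ ≤ C * ε ^ κ₁ / (K₁ * K₂ * (D : ℝ) ^ e) := hstep2
    _ ≤ I := hstep1

/-- Settles the glue item `stmt-QuantumAdvantage-17875` (route RandomOracleGauge, support `AAConjAssembly`):
with it the conjecture-grade crux `AAConj` is DERIVED from the three pieces. [cite: ODonnellZhao2016, Thm. 2.13] -/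
theorem AAConjAssembly_proof : AAConjAssembly := fun hCore hOZ hAmp => AAConj_of_subs hCore hOZ hAmp

end Summit.QuantumAdvantage.QuantumAdvantage.Theorems.RandomOracleGauge
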